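import Mathlib
import Summits.Ventures.PercRepro2.CutVertexSplit

/-!
# The cut vertex separating the roots, II: the cubic form conditioned on the `h`-states (blind
cell PercRepro2, p3 g2, 2026-08-25; `proofs/P3-BRIDGE.md` §10.8)

For a cut-vertex instance (`CutVertex`, `CutVertexSplit.lean`) the cubic form of (HCOV) is a sum
over the triples of `h`-states `t = (t₁, t₂, t₃)` of the `h`-side probabilities times an `l`-side
cubic form with COPY-WISE MIXED MARKINGS:

  `Gc = Σ_{t₁ t₂ t₃} pH t₁ · pH t₂ · pH t₃ · Wt t₁ t₂ t₃`   (`Gc_eq_sum_hstates`),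

`pH t = P(h-state = t)` and `Wt t₁ t₂ t₃ = Σ_{x,y,z} P(x)P(y)P(z) · KB(glued(lst x, t₁), glued(lst y, t₂),
glued(lst z, t₃))` (the kernel `K₃` evaluated with copy `k` carrying the marking of `t_k`).  Proof:
`hcov_cubic` + `K3_eq_KB` + `st_eq_glued`, the case split over the `h`-state of each copy, and the
product rule `expect_mul_eq_mul_of_dependsOn` copy by copy (the `h`-state depends on the edges
within `VH`, the `l`-state on those within `VL`; disjoint by `noloop`).  Hence (HCOV) on the class
follows from `Wt ≥ 0` for the 35 multisets of `h`-states — the pieces of `CutVertexPieces.lean`.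
Own work; standard axioms.
-/

namespace Summit.Ventures.PercRepro2

open UnionCluster

namespace CovForm

namespace RootBridge

open OneTyped

section Cubic

open Classical

variable {V : Type*} {E : Type*} [Fintype E] [DecidableEq E] {R : Type*} [Field R]
variable (p : E → R) (ends : E → Sym2 V) (o a₁ a₂ a₃ b c : V) (VL VH : Set V)

/-- The indicator of the `h`-state `t`. -/
noncomputable def hInd (t : HState) (x : Config E) : R :=
  if hstC ends c a₂ a₃ VH x = t then 1 else 0

/-- The law of the `h`-state: `pH t = P(h-state = t)`. -/
noncomputable def pH (t : HState) : R := expect p (hInd ends a₂ a₃ c VH t)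

/-- The kernel with copy-wise markings `t₁, t₂, t₃` on `l`-states. -/
noncomputable def Kt (t₁ t₂ t₃ : HState) (l₁ l₂ l₃ : LSt) : R :=
  ((KB (gluedSt l₁ t₁) (gluedSt l₂ t₂) (gluedSt l₃ t₃) : ℤ) : R)

/-- The `l`-side cubic form with copy-wise markings. -/
noncomputable def Wt (t₁ t₂ t₃ : HState) : R :=
  ∑ x : Config E, ∑ y : Config E, ∑ z : Config E, weight p x * weight p y * weight p z *
    Kt t₁ t₂ t₃ (lstC ends o a₁ b c VL x) (lstC ends o a₁ b c VL y) (lstC ends o a₁ b c VL z)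

omit [Fintype E] [DecidableEq E] in
/-- The side restriction depends only on the edges within the side. -/
lemma withinRestr_congr (W : Set V) {x x' : Config E}
    (h : ∀ e ∈ within ends W, x e = x' e) : withinRestr ends W x = withinRestr ends W x' := by
  funext e
  unfold withinRestr
  split_ifs with he
  · exact h e he
  · rfl

omit [Fintype E] [DecidableEq E] in
/-- The `h`-state indicator depends only on the edges within `VH`. -/
lemma dependsOn_hInd (t : HState) : DependsOn (hInd ends a₂ a₃ c VH t : Config E → R) (within ends VH) := by
  intro x x' h
  unfold hInd hstC
  rw [withinRestr_congr ends VH h]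

omit [Fintype E] [DecidableEq E] [Field R] in
/-- Any function of the `l`-state depends only on the edges within `VL`. -/
lemma dependsOn_lst (G : LSt → R) :
    DependsOn (fun x => G (lstC ends o a₁ b c VL x)) (within ends VL) := by
  intro x x' h
  simp only
  unfold lstC
  rw [withinRestr_congr ends VL h]

omit [Fintype E] [DecidableEq E] [Field R] in
/-- The sides carry disjoint edge sets. -/
lemma disjoint_within {VL VH : Set V} (h : CutVertex ends o a₁ a₂ a₃ b c VL VH) :
    Disjoint (within ends VL) (within ends VH) :=
  Set.disjoint_left.2 fun e heL heH => h.noloop e ⟨heL, heH⟩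

/-- **One copy factorises**: the `h`-state indicator and a function of the `l`-state are
independent. -/
lemma sum_hInd_mul {VL VH : Set V} (h : CutVertex ends o a₁ a₂ a₃ b c VL VH) (t : HState)
    (G : LSt → R) :
    ∑ x : Config E, weight p x * (hInd ends a₂ a₃ c VH t x * G (lstC ends o a₁ b c VL x)) =
      pH p ends a₂ a₃ c VH t * ∑ x : Config E, weight p x * G (lstC ends o a₁ b c VL x) := by
  have key : expect p (hInd ends a₂ a₃ c VH t * fun x => G (lstC ends o a₁ b c VL x)) =
      expect p (hInd ends a₂ a₃ c VH t) * expect p (fun x => G (lstC ends o a₁ b c VL x)) :=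
    expect_mul_eq_mul_of_dependsOn p (disjoint_within ends o a₁ a₂ a₃ b c h).symm
      (dependsOn_hInd ends a₂ a₃ c VH t) (dependsOn_lst ends o a₁ b c VL G)
  unfold expect at key
  simp only [Pi.mul_apply] at key
  unfold pH expect
  exact key

/-- The one-copy factorisation with a constant factor. -/
lemma sum_hInd_mul' {VL VH : Set V} (h : CutVertex ends o a₁ a₂ a₃ b c VL VH) (t : HState)
    (G : LSt → R) (a : R) :
    ∑ x : Config E, weight p x * (hInd ends a₂ a₃ c VH t x * (a * G (lstC ends o a₁ b c VL x))) =
      pH p ends a₂ a₃ c VH t * (a * ∑ x : Config E, weight p x * G (lstC ends o a₁ b c VL x)) := by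
  rw [sum_hInd_mul p ends o a₁ a₂ a₃ b c h t (fun l => a * G l)]
  congr 1
  rw [Finset.mul_sum]
  exact Finset.sum_congr rfl fun x _ => by ring

omit [Fintype E] [DecidableEq E] in
/-- Case split of a function of the `h`-state over the five states. -/
lemma sum_hInd_eq (x : Config E) (F : HState → R) :
    ∑ t : HState, hInd ends a₂ a₃ c VH t x * F t = F (hstC ends c a₂ a₃ VH x) := by
  unfold hInd
  rw [Finset.sum_eq_single (hstC ends c a₂ a₃ VH x)]
  · simp
  · intro t _ ht
    simp [Ne.symm ht]
  · intro h
    exact absurd (Finset.mem_univ _) h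

/-- **The triple sum factorises** over the three `h`-state indicators. -/
lemma triple_factor {VL VH : Set V} (h : CutVertex ends o a₁ a₂ a₃ b c VL VH)
    (t₁ t₂ t₃ : HState) (K : LSt → LSt → LSt → R) :
    (∑ x : Config E, ∑ y : Config E, ∑ z : Config E, weight p x * weight p y * weight p z *
        (hInd ends a₂ a₃ c VH t₁ x * hInd ends a₂ a₃ c VH t₂ y * hInd ends a₂ a₃ c VH t₃ z *
          K (lstC ends o a₁ b c VL x) (lstC ends o a₁ b c VL y) (lstC ends o a₁ b c VL z))) =
      pH p ends a₂ a₃ c VH t₁ * pH p ends a₂ a₃ c VH t₂ * pH p ends a₂ a₃ c VH t₃ *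
        ∑ x : Config E, ∑ y : Config E, ∑ z : Config E, weight p x * weight p y * weight p z *
          K (lstC ends o a₁ b c VL x) (lstC ends o a₁ b c VL y) (lstC ends o a₁ b c VL z) := by
  set w : Config E → R := weight p with hw
  set I : HState → Config E → R := hInd ends a₂ a₃ c VH with hI
  set L : Config E → LSt := lstC ends o a₁ b c VL with hL
  set q : HState → R := pH p ends a₂ a₃ c VH with hq
  -- nest the summands
  have nest : ∀ x y : Config E, (∑ z : Config E, w x * w y * w z * (I t₁ x * I t₂ y * I t₃ z * K (L x) (L y) (L z))) =
      w x * (I t₁ x * (w y * (I t₂ y * ∑ z : Config E, w z * (I t₃ z * K (L x) (L y) (L z))))) := by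
    intro x y
    rw [Finset.mul_sum, Finset.mul_sum, Finset.mul_sum, Finset.mul_sum]
    refine Finset.sum_congr rfl fun z _ => ?_
    ring
  have inner : ∀ x y : Config E, (∑ z : Config E, w z * (I t₃ z * K (L x) (L y) (L z))) =
      q t₃ * ∑ z : Config E, w z * K (L x) (L y) (L z) := fun x y =>
    sum_hInd_mul p ends o a₁ a₂ a₃ b c h t₃ (fun l => K (L x) (L y) l)
  have middle : ∀ x : Config E, (∑ y : Config E, w y * (I t₂ y * (q t₃ * ∑ z : Config E, w z * K (L x) (L y) (L z)))) =
      q t₂ * (q t₃ * ∑ y : Config E, w y * ∑ z : Config E, w z * K (L x) (L y) (L z)) := fun x =>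
    sum_hInd_mul' p ends o a₁ a₂ a₃ b c h t₂ (fun l => ∑ z : Config E, w z * K (L x) l (L z)) (q t₃)
  have outer : (∑ x : Config E, w x * (I t₁ x * ((q t₂ * q t₃) * ∑ y : Config E, w y * ∑ z : Config E, w z * K (L x) (L y) (L z)))) =
      q t₁ * ((q t₂ * q t₃) * ∑ x : Config E, w x * ∑ y : Config E, w y * ∑ z : Config E, w z * K (L x) (L y) (L z)) :=
    sum_hInd_mul' p ends o a₁ a₂ a₃ b c h t₁ (fun l => ∑ y : Config E, w y * ∑ z : Config E, w z * K l (L y) (L z)) (q t₂ * q t₃)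
  have unnest : (∑ x : Config E, ∑ y : Config E, ∑ z : Config E, w x * w y * w z * K (L x) (L y) (L z)) =
      ∑ x : Config E, w x * ∑ y : Config E, w y * ∑ z : Config E, w z * K (L x) (L y) (L z) := by
    refine Finset.sum_congr rfl fun x _ => ?_
    rw [Finset.mul_sum]
    refine Finset.sum_congr rfl fun y _ => ?_
    rw [Finset.mul_sum, Finset.mul_sum]
    refine Finset.sum_congr rfl fun z _ => ?_
    ring
  calc (∑ x : Config E, ∑ y : Config E, ∑ z : Config E, w x * w y * w z *
        (I t₁ x * I t₂ y * I t₃ z * K (L x) (L y) (L z)))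
      = ∑ x : Config E, w x * (I t₁ x * ∑ y : Config E, w y * (I t₂ y * ∑ z : Config E, w z * (I t₃ z * K (L x) (L y) (L z)))) := by
        refine Finset.sum_congr rfl fun x _ => ?_
        rw [Finset.mul_sum, Finset.mul_sum]
        exact Finset.sum_congr rfl fun y _ => nest x y
    _ = ∑ x : Config E, w x * (I t₁ x * ∑ y : Config E, w y * (I t₂ y * (q t₃ * ∑ z : Config E, w z * K (L x) (L y) (L z)))) := by
        refine Finset.sum_congr rfl fun x _ => ?_
        congr 2
        exact Finset.sum_congr rfl fun y _ => by rw [inner x y]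
    _ = ∑ x : Config E, w x * (I t₁ x * ((q t₂ * q t₃) * ∑ y : Config E, w y * ∑ z : Config E, w z * K (L x) (L y) (L z))) := by
        refine Finset.sum_congr rfl fun x _ => ?_
        rw [middle x, mul_assoc]
    _ = q t₁ * ((q t₂ * q t₃) * ∑ x : Config E, w x * ∑ y : Config E, w y * ∑ z : Config E, w z * K (L x) (L y) (L z)) := outer
    _ = q t₁ * q t₂ * q t₃ * ∑ x : Config E, ∑ y : Config E, ∑ z : Config E, w x * w y * w z * K (L x) (L y) (L z) := by
        rw [unnest]
        ring

/-- Moving an innermost sum across three outer ones. -/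
lemma sum_comm3 {A B C D : Type*} [Fintype A] [Fintype B] [Fintype C] [Fintype D]
    {S : Type*} [AddCommMonoid S] (f : A → B → C → D → S) :
    (∑ a : A, ∑ b : B, ∑ c : C, ∑ d : D, f a b c d) = ∑ d : D, ∑ a : A, ∑ b : B, ∑ c : C, f a b c d := by
  have h1 : (∑ a : A, ∑ b : B, ∑ c : C, ∑ d : D, f a b c d) = ∑ a : A, ∑ b : B, ∑ d : D, ∑ c : C, f a b c d :=
    Finset.sum_congr rfl fun a _ => Finset.sum_congr rfl fun b _ => Finset.sum_comm
  have h2 : (∑ a : A, ∑ b : B, ∑ d : D, ∑ c : C, f a b c d) = ∑ a : A, ∑ d : D, ∑ b : B, ∑ c : C, f a b c d :=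
    Finset.sum_congr rfl fun a _ => Finset.sum_comm
  rw [h1, h2]
  exact Finset.sum_comm

end Cubic

section Main

open Classical

variable {V : Type*} {E : Type*} [Fintype E] [DecidableEq E] {R : Type*}
  [Field R] [LinearOrder R] [IsStrictOrderedRing R]
variable (p : E → R) (ends : E → Sym2 V) (o a₁ a₂ a₃ b c : V)

/-- **(HCOV)'s cubic form on a cut-vertex instance is the `h`-state-conditioned sum.** -/
theorem Gc_eq_sum_hstates {VL VH : Set V} (h : CutVertex ends o a₁ a₂ a₃ b c VL VH) :
    Gc p ends o a₁ a₂ a₃ b =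
      ∑ t₁ : HState, ∑ t₂ : HState, ∑ t₃ : HState,
        pH p ends a₂ a₃ c VH t₁ * pH p ends a₂ a₃ c VH t₂ * pH p ends a₂ a₃ c VH t₃ *
          Wt p ends o a₁ b c VL t₁ t₂ t₃ := by
  rw [hcov_cubic p ends o a₁ a₂ a₃ b (fun _ => 0), triSum_empty]
  -- the kernel on glued states
  have hK : ∀ x y z : Config E, (K3 ends o a₁ a₂ a₃ b x y z : R) =
      ∑ t₁ : HState, ∑ t₂ : HState, ∑ t₃ : HState,
        hInd ends a₂ a₃ c VH t₁ x * hInd ends a₂ a₃ c VH t₂ y * hInd ends a₂ a₃ c VH t₃ z *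
          Kt t₁ t₂ t₃ (lstC ends o a₁ b c VL x) (lstC ends o a₁ b c VL y) (lstC ends o a₁ b c VL z) := by
    intro x y z
    rw [K3_eq_KB, st_eq_glued ends o a₁ a₂ a₃ b c h x, st_eq_glued ends o a₁ a₂ a₃ b c h y,
      st_eq_glued ends o a₁ a₂ a₃ b c h z]
    symm
    rw [show (∑ t₁ : HState, ∑ t₂ : HState, ∑ t₃ : HState,
        hInd ends a₂ a₃ c VH t₁ x * hInd ends a₂ a₃ c VH t₂ y * hInd ends a₂ a₃ c VH t₃ z *
          Kt t₁ t₂ t₃ (lstC ends o a₁ b c VL x) (lstC ends o a₁ b c VL y) (lstC ends o a₁ b c VL z)) =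
        ∑ t₁ : HState, hInd ends a₂ a₃ c VH t₁ x * (∑ t₂ : HState, hInd ends a₂ a₃ c VH t₂ y *
          (∑ t₃ : HState, hInd ends a₂ a₃ c VH t₃ z *
            Kt t₁ t₂ t₃ (lstC ends o a₁ b c VL x) (lstC ends o a₁ b c VL y) (lstC ends o a₁ b c VL z))) from
        Finset.sum_congr rfl fun t₁ _ => by
          rw [Finset.mul_sum]
          refine Finset.sum_congr rfl fun t₂ _ => ?_
          rw [Finset.mul_sum, Finset.mul_sum]
          refine Finset.sum_congr rfl fun t₃ _ => ?_
          ring]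
    rw [sum_hInd_eq ends a₂ a₃ c VH x]
    rw [sum_hInd_eq ends a₂ a₃ c VH y]
    rw [sum_hInd_eq ends a₂ a₃ c VH z]
    rfl
  simp_rw [hK]
  simp_rw [Finset.mul_sum]
  rw [sum_comm3, Finset.sum_congr rfl fun t₁ _ => sum_comm3 _]
  refine Finset.sum_congr rfl fun t₁ _ => ?_
  rw [Finset.sum_congr rfl fun t₂ _ => sum_comm3 _]
  refine Finset.sum_congr rfl fun t₂ _ => Finset.sum_congr rfl fun t₃ _ => ?_
  exact triple_factor p ends o a₁ a₂ a₃ b c h t₁ t₂ t₃ _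

end Main

end RootBridge

end CovForm

end Summit.Ventures.PercRepro2
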